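import Mathlib
import HarnessLib

/-!
# `DensityLadder.SeparatedTowerDensityLine` (item stmt-RiemannHypothesis-24918) — the test bump of
# stub S1

LINE L57 «sieve sight above the density line» (rh-idea-10 g1), crux K1 `SeparatedTowerDensityLine`
(stmt-RiemannHypothesis-24918), stub S1 `stub_separatedMeanValueCount`.  The explicit-formula
hypothesis of K1 is quantified over `C²` bumps `φ ≥ 0` vanishing for `|v| ≥ 1`; the mean-value
argument instantiates it at ONE such bump with `∫_{-1}^{1} φ ≥ 1`, bounded by `1`, with bounded second
derivative.  This file exhibits it (Mathlib's `ContDiffBump` with radii `1/2 < 1`), packaged as the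
single existential `exists_testBump` the assembly consumes.  Cell rh-split, seat
rh-split-prover-l57b g0.  RH-free, ζ-free; FRONTIER bookkeeping (DH-capped); nothing here bears on
the truth of RH.
-/

set_option linter.dupNamespace false

noncomputable section

open Set MeasureTheory Topology Metric

namespace Summit.RiemannHypothesis.RiemannHypothesis.Theorems.DensityLadderSeparatedTowerTestBump

/-- **The test bump.**  There is `φ : ℝ → ℝ` of class `C²`, continuous, with `0 ≤ φ ≤ 1`,
`φ(v) = 0` for `|v| ≥ 1`, `|φ| ≤ M`, `|φ''| ≤ M₂` for some constants `M, M₂`, and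
`1 ≤ ∫_{-1}^{1} φ` (it equals `1` on `[−1/2, 1/2]`). [folklore] -/
theorem exists_testBump :
    ∃ (φ : ℝ → ℝ) (M M₂ : ℝ), ContDiff ℝ 2 φ ∧ Continuous φ ∧ (∀ v, 0 ≤ φ v) ∧ (∀ v, φ v ≤ 1) ∧
      (∀ v, 1 ≤ |v| → φ v = 0) ∧ (∀ v, |φ v| ≤ M) ∧ (∀ v, |deriv (deriv φ) v| ≤ M₂) ∧
      1 ≤ ∫ v in (-1 : ℝ)..1, φ v := by
  let f : ContDiffBump (0 : ℝ) := ⟨1 / 2, 1, by norm_num, by norm_num⟩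
  have hcd : ContDiff ℝ 2 f := f.contDiff
  have hcont : Continuous f := f.continuous
  have h0 : ∀ v, 0 ≤ f v := fun v ↦ f.nonneg
  have h1 : ∀ v, f v ≤ 1 := fun v ↦ f.le_one
  have hsupp : ∀ v : ℝ, 1 ≤ |v| → f v = 0 := by
    intro v hv
    apply f.zero_of_le_dist
    simpa [Real.dist_eq] using hv
  -- second derivative: continuous with compact support, hence bounded
  have hd2c : Continuous (deriv (deriv f)) := by
    have h1' : ContDiff ℝ 1 (deriv f) := hcd.deriv'
    exact h1'.continuous_deriv le_rfl
  have hd2s : HasCompactSupport (deriv (deriv f)) := f.hasCompactSupport.deriv.deriv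
  obtain ⟨M₂, hM₂⟩ := hd2c.bounded_above_of_compact_support hd2s
  refine ⟨f, 1, M₂, hcd, hcont, h0, h1, hsupp, fun v ↦ ?_, fun v ↦ ?_, ?_⟩
  · rw [abs_of_nonneg (h0 v)]; exact h1 v
  · simpa [Real.norm_eq_abs] using hM₂ v
  · -- `∫_{-1}^{1} f ≥ ∫_{-1/2}^{1/2} f = 1`
    have hii : ∀ a b : ℝ, IntervalIntegrable (fun v ↦ (f v : ℝ)) volume a b := fun a b ↦
      hcont.intervalIntegrable a b
    have hsplit : ∫ v in (-1 : ℝ)..1, f v =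
        (∫ v in (-1 : ℝ)..(-(1 / 2)), f v) + ((∫ v in (-(1 / 2) : ℝ)..(1 / 2), f v) +
          ∫ v in (1 / 2 : ℝ)..1, f v) := by
      rw [intervalIntegral.integral_add_adjacent_intervals (hii _ _) (hii _ _),
        intervalIntegral.integral_add_adjacent_intervals (hii _ _) (hii _ _)]
    have hmid : ∫ v in (-(1 / 2) : ℝ)..(1 / 2), f v = 1 := by
      have : ∫ v in (-(1 / 2) : ℝ)..(1 / 2), f v = ∫ v in (-(1 / 2) : ℝ)..(1 / 2), (1 : ℝ) := by
        refine intervalIntegral.integral_congr fun v hv ↦ ?_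
        rw [uIcc_of_le (by norm_num), mem_Icc] at hv
        apply f.one_of_mem_closedBall
        rw [mem_closedBall, Real.dist_eq, sub_zero]
        exact abs_le.2 ⟨hv.1, hv.2⟩
      rw [this, intervalIntegral.integral_const]; norm_num
    have hA : 0 ≤ ∫ v in (-1 : ℝ)..(-(1 / 2)), f v :=
      intervalIntegral.integral_nonneg (by norm_num) fun v _ ↦ h0 v
    have hB : 0 ≤ ∫ v in (1 / 2 : ℝ)..1, f v :=
      intervalIntegral.integral_nonneg (by norm_num) fun v _ ↦ h0 v
    rw [hsplit, hmid]
    linarith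

end Summit.RiemannHypothesis.RiemannHypothesis.Theorems.DensityLadderSeparatedTowerTestBump

end
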